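import Summits.RiemannHypothesis.RiemannHypothesis.Theorems.WeilFormatCCinfExactTables
import HarnessLib

/-!
# Format C, design C∞ (E2, data side): entrywise SUM of two claimed tables

Route context: Fourier–Galerkin / Schur-complement certificates of Weil positivity on a window ("format C", C∞ door
`weilPositivityOn_of_cinf_pipeline`; supporting stmt-RiemannHypothesis-0098; seat rh-explicit-weil-2, cell memo
`…/rh-explicit-weil-2/gen17/EMITTER-PHASE2.md` §2).  The remainder stage of the certificate pipeline writes `ρ̃ = (L-stage) + (T-stage)`
and `Rtot = (T) + (T)` (`CinfRemE.rtilR_eq`, `RtotR_eq`); this file supplies the one missing glue step: the claimed table of a sum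
`f + g` is the entrywise sum of the claimed tables (same scale; radii add).

* `CinfGlue2.addZ` — entrywise sum of two integer tables (rows zipped; the shape check guards equal lengths);
* `CinfGlue2.checkAddShape` — both tables have `n` rows of length `k`;
* ★ `CinfGlue2.TabNear.add` — `TabNear f n k c ρ₁ Z₁ → TabNear g n k c ρ₂ Z₂ → checkAddShape → TabNear (f + g) n k c (ρ₁ + ρ₂) (addZ Z₁ Z₂)`.

Bookkeeping only; standard axioms; no RH claim.
-/

set_option autoImplicit false
-- `Summit.RiemannHypothesis.RiemannHypothesis.…` is the layout-mandated namespace (summit = problem name).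
set_option linter.dupNamespace false

namespace Summit.RiemannHypothesis.RiemannHypothesis.Theorems.WeilFormatC

open Literature.NumberTheory.LFunctions (PsdDyadic.getMZ)

namespace CinfGlue2

/-- Entrywise sum of two integer tables. -/
def addZ (Z₁ Z₂ : List (List ℤ)) : List (List ℤ) :=
  List.zipWith (fun r₁ r₂ ↦ List.zipWith (· + ·) r₁ r₂) Z₁ Z₂

/-- Shape check: both tables have at least `n` rows and rows `i < n` of both have length exactly `k`. -/
def checkAddShape (Z₁ Z₂ : List (List ℤ)) (n k : ℕ) : Bool :=
  decide (n ≤ Z₁.length) && decide (n ≤ Z₂.length)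
    && CinfExact.allFromTo 0 n fun i ↦ decide ((Z₁.getD i []).length = k) && decide ((Z₂.getD i []).length = k)

/-- Entries of `addZ` inside the checked shape. -/
theorem getMZ_addZ {Z₁ Z₂ : List (List ℤ)} {n k : ℕ} (h : checkAddShape Z₁ Z₂ n k = true) {i j : ℕ}
    (hi : i < n) (hj : j < k) :
    PsdDyadic.getMZ (addZ Z₁ Z₂) i j = PsdDyadic.getMZ Z₁ i j + PsdDyadic.getMZ Z₂ i j := by
  simp only [checkAddShape, Bool.and_eq_true, decide_eq_true_eq] at h
  obtain ⟨⟨h1, h2⟩, h3⟩ := h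
  have h4 := CinfExact.allFromTo_spec h3 i (Nat.zero_le _) (by simpa using hi)
  simp only [Bool.and_eq_true, decide_eq_true_eq] at h4
  obtain ⟨hl1, hl2⟩ := h4
  have hi1 : i < Z₁.length := by omega
  have hi2 : i < Z₂.length := by omega
  have g1 : Z₁.getD i [] = Z₁[i] := by simp [List.getD_eq_getElem?_getD, List.getElem?_eq_getElem hi1]
  have g2 : Z₂.getD i [] = Z₂[i] := by simp [List.getD_eq_getElem?_getD, List.getElem?_eq_getElem hi2]
  rw [g1] at hl1; rw [g2] at hl2
  have hj1 : j < Z₁[i].length := by omega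
  have hj2 : j < Z₂[i].length := by omega
  have hz : (addZ Z₁ Z₂).getD i [] = List.zipWith (· + ·) Z₁[i] Z₂[i] := by
    rw [addZ, List.getD_eq_getElem?_getD, List.getElem?_zipWith, List.getElem?_eq_getElem hi1,
      List.getElem?_eq_getElem hi2]
    rfl
  simp only [PsdDyadic.getMZ, hz, g1, g2, List.getD_eq_getElem?_getD, List.getElem?_zipWith,
    List.getElem?_eq_getElem hj1, List.getElem?_eq_getElem hj2]
  rfl

/-- ★ **Sum of two claims** at one scale: radii add. -/
theorem TabNear.add {f g : ℕ → ℕ → ℝ} {n k c ρ₁ ρ₂ : ℕ} {Z₁ Z₂ : List (List ℤ)}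
    (h₁ : CinfExact.TabNear f n k c ρ₁ Z₁) (h₂ : CinfExact.TabNear g n k c ρ₂ Z₂)
    (hs : checkAddShape Z₁ Z₂ n k = true) :
    CinfExact.TabNear (fun i j ↦ f i j + g i j) n k c (ρ₁ + ρ₂) (addZ Z₁ Z₂) := by
  refine ⟨fun i hi j hj ↦ ?_⟩
  rw [getMZ_addZ hs hi hj]
  have e1 := h₁.out i hi j hj
  have e2 := h₂.out i hi j hj
  push_cast
  rw [add_div, add_div]
  calc |f i j + g i j - ((PsdDyadic.getMZ Z₁ i j : ℝ) / 2 ^ c + (PsdDyadic.getMZ Z₂ i j : ℝ) / 2 ^ c)|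
      = |(f i j - (PsdDyadic.getMZ Z₁ i j : ℝ) / 2 ^ c) + (g i j - (PsdDyadic.getMZ Z₂ i j : ℝ) / 2 ^ c)| := by ring_nf
    _ ≤ |f i j - (PsdDyadic.getMZ Z₁ i j : ℝ) / 2 ^ c| + |g i j - (PsdDyadic.getMZ Z₂ i j : ℝ) / 2 ^ c| := abs_add_le _ _
    _ ≤ (ρ₁ : ℝ) / 2 ^ c + (ρ₂ : ℝ) / 2 ^ c := add_le_add e1 e2

end CinfGlue2

end Summit.RiemannHypothesis.RiemannHypothesis.Theorems.WeilFormatC
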